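import Literature.Analysis.Complex.TwoConstantsDisc
import Literature.MathematicalPhysics.QuantumFieldTheory.Balaban1983to89.T4InputCauchyRateData

/-!
# OutputRateComplexSlice — W1 AT COMPLEX CHART POINTS from the REAL-slice rate and holomorphy of the operator families along
# complex one-parameter slices (the two-constants theorem, `Literature.Analysis.Complex.TwoConstantsDisc`), with the explicit loss of
# rate exponent `θ ↦ θ^{1−λ(r)}`

Cell `pub-balaban`, unit `b2b-balaban-t4-ne5-p1` (row NE5 OWNER, gen 35; owner item «g35-d» = the typed junction of RULING R49 (4)'s HONEST
RIDER, `HOME/CLAIMS.log` l.16073 ∕ l.16513).  Summits-side NEW WORK under the LEAN PLACEMENT RULE ([folklore] bookkeeping over an ABSTRACT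
chart; nothing printed is asserted; no `[cite:]`; no `Prop`-valued fact minted; 0 `def`).  HONEST FRAMING: rung (B)+1 of the FINITE-VOLUME
T⁴ continuum programme — NOT infinite volume, NOT a mass gap, NOT the Clay problem, NOT a proof of NE5 (NOT PRINTED; GAPS G-t4-U3-1), NOT a
proof of NE2 or NE3.  HONEST DEPENDENCY (cell, verbatim): continuum YM on T⁴ ⇐ BetaPertH ∧ nine spine estimates (0/9 proved); BetaPertH ⇐
(D1) ∧ (D4) ∧ CAP+tail; G-an2-4 gates asym, D1 and NE2/3/4.

WHY.  On Road D of record (R49) the renormalisation step reads the earlier terms on the COMPLEX small-field chart, so the kernel's W1 binder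
(`OutputRateFunctionalTablesFamily.FamilySlots.operatorRate_iff_pointwise`: `‖opA g k u − opB g k u‖ ≤ δ·θ^k·rOp k` at EVERY chart point
`u`) is consumed at COMPLEX backgrounds, whereas rows NE2 ∕ NE3 type their two-spacing rates on REAL configurations.  This module shows
— abstractly, for any chart `𝒰`, any «real» subset and any operator families — that the complex-point rate FOLLOWS from (i) the rate on the
real points, (ii) holomorphy and a uniform bound of the two families' DIFFERENCE along complex one-parameter slices through every chart
point whose real diameter lies in the real subset (printed KIND: [Balaban1988RG2Cluster] (1.5) p. 3, p. 6 «all the considered functions and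
operators are analytic functions of the configurations 𝐔, 𝐉 … and all the bounds above are uniform on the domain»), at the cost of the
exponent: `(δ, θ) ↦ (δ^{1−λ}·(2B)^{λ}, θ^{1−λ})`, `λ = λ(r) = (2/π)·arctan(2r∕(1−r²)) < 1` for slices read at relative depth `≤ r < 1`.  At the
instance the subset `real` is the REAL TRACE OF THE SLICES' DISCS — the chart's real points ENLARGED in the real directions by the analyticity radius (print's nested
enlargement `(1+β)α₀` of [Balaban1988RG2Cluster] Lemma 1 (1.33) p. 9 is the KIND) — and ONE depth letter `r` serves all levels (that is what makes the output `k`-uniform: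
`operatorRate_complex_of_realSlice_all`).  HONEST (substrate-typer T-g35d-2, accepted): hypothesis (i) is consumed on the WHOLE real diameter of every slice, i.e. on
ALL regular real (unitary) backgrounds of the real window — a BACKGROUND-GENERIC two-spacing rate; the W1 faces of record (`B13ReadingsRecord`, fed by row NE3's
`NE3Shape` through the reading map `tow`) supply it at the backgrounds READ as tower members; on the rest of the window it is a displayed rate of rows NE2∕NE3's KIND
at regular backgrounds, asserted by nobody.

WHAT ([folklore]; 0 def).  `operatorRate_complex_of_realSlice` (the junction, per level and window; the DIFFERENCE hypothesised along the slices),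
`operatorRate_complex_of_realSlice_each` (each family's slice hypothesised separately, bound `B·rOp k` each), `operatorRate_complex_of_realSlice_all` (all levels, ONE depth
`r` and ONE `B`: EXACTLY the right-hand side of `OutputRateFunctionalTablesFamily.FamilySlots.operatorRate_iff_pointwise` with the level-free pair `(δ′, θ′)`) and
`rate_rpow_lt_one` (`θ^{1−λ} < 1` for `θ < 1`, `λ < 1`).  WHAT IS NOT HERE: no instance (the slices `γ`, the real section, the families are the substrate's D-8 ∕ O-8
objects — Q-S16); no estimate of [II]; rows NE2 ∕ NE3 are consumed on REAL points only.  0 sorry; axioms ⊆ {propext, Classical.choice,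
Quot.sound}.
-/

noncomputable section

open Complex Set Metric Real

namespace Summit.QuantumFields.BalabanUV.T4Continuum.OutputRateComplexSlice

open Literature.Analysis.Complex.TwoConstantsDisc

variable {𝒰 : Type} {Op : Type*} [NormedAddCommGroup Op] [NormedSpace ℂ Op]

/-- [folklore] The degraded rate is still a rate: `θ^{1−λ} < 1` for `0 ≤ θ < 1` and `λ < 1`. -/
theorem rate_rpow_lt_one {θ l : ℝ} (hθ : 0 ≤ θ) (hθ1 : θ < 1) (hl : l < 1) : θ ^ (1 - l) < 1 :=
  Real.rpow_lt_one hθ hθ1 (by linarith)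

/-- [folklore] **W1 AT COMPLEX CHART POINTS FROM THE REAL-SLICE RATE AND HOLOMORPHY ALONG SLICES.**  Let `opA opB : (ℕ → ℝ) → ℕ → 𝒰 → Op`
be the two runs' operator families on a chart `𝒰` with a distinguished subset `real` of chart points and a set `dom` of CHARTED points (at the instance: the
small-field ball of the chart on which the families are analytic — substrate-typer (κ5)∕T-g35d-1; `dom = Set.univ` is the total form).  Suppose, at level
`k` and window `W`:
(i) the rate `‖opA g k u − opB g k u‖ ≤ δ·θ^k·rOp k` holds at every `u ∈ real`; (ii) through every charted point `u ∈ dom` there is a complex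
one-parameter slice `γ : ℂ → 𝒰` with `γ z₀ = u`, `‖z₀‖ ≤ r`, real diameter in `real` (`γ x ∈ real` for real `|x| < 1`), along which the
DIFFERENCE of the two families is holomorphic in the open unit disc, continuous on the closed disc and bounded there by `2B·rOp k`; and
`0 ≤ δ ≤ 2B`, `0 ≤ θ ≤ 1`, `0 ≤ rOp k`, `r < 1`.  Then at EVERY charted point `u ∈ dom`,
`‖opA g k u − opB g k u‖ ≤ (δ^{1−λ}·(2B)^{λ})·(θ^{1−λ})^k·rOp k`, `λ = (2/π)·arctan(2r∕(1−r²))` — the two-constants theorem on the disc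
(`norm_le_two_constants_disc_of_norm_le`) with `m = δθ^k·rOp k`, `M = 2B·rOp k`. -/
theorem operatorRate_complex_of_realSlice {opA opB : (ℕ → ℝ) → ℕ → 𝒰 → Op} {W : Set (ℕ → ℝ)} {real dom : Set 𝒰}
    {δ θ B r : ℝ} {rOp : ℕ → ℝ} {k : ℕ} (hδ : 0 ≤ δ) (hδB : δ ≤ 2 * B) (hθ : 0 ≤ θ) (hθ1 : θ ≤ 1) (hrOp : 0 ≤ rOp k)
    (hr : r < 1)
    (hreal : ∀ g ∈ W, ∀ u ∈ real, ‖opA g k u - opB g k u‖ ≤ δ * θ ^ k * rOp k)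
    (hslice : ∀ g ∈ W, ∀ u ∈ dom, ∃ γ : ℂ → 𝒰, ∃ z₀ : ℂ, ‖z₀‖ ≤ r ∧ γ z₀ = u ∧ (∀ x : ℝ, |x| < 1 → γ x ∈ real) ∧
      DiffContOnCl ℂ (fun z => opA g k (γ z) - opB g k (γ z)) (ball 0 1) ∧
        ∀ z : ℂ, ‖z‖ ≤ 1 → ‖opA g k (γ z) - opB g k (γ z)‖ ≤ 2 * B * rOp k) :
    ∀ g ∈ W, ∀ u ∈ dom, ‖opA g k u - opB g k u‖ ≤
      (δ ^ (1 - 2 / π * Real.arctan (2 * r / (1 - r ^ 2))) * (2 * B) ^ (2 / π * Real.arctan (2 * r / (1 - r ^ 2)))) *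
        (θ ^ (1 - 2 / π * Real.arctan (2 * r / (1 - r ^ 2)))) ^ k * rOp k := by
  intro g hg u hu
  obtain ⟨γ, z₀, hz₀, hγu, hγreal, hdiff, hbd⟩ := hslice g hg u hu
  set l : ℝ := 2 / π * Real.arctan (2 * r / (1 - r ^ 2)) with hl
  have hB : 0 ≤ 2 * B := hδ.trans hδB
  have hθk : θ ^ k ≤ 1 := pow_le_one₀ hθ hθ1
  -- the two constants
  have hm : ∀ x : ℝ, |x| < 1 → ‖opA g k (γ x) - opB g k (γ x)‖ ≤ δ * θ ^ k * rOp k := fun x hx =>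
    hreal g hg (γ x) (hγreal x hx)
  have hmM : δ * θ ^ k * rOp k ≤ 2 * B * rOp k := by
    have : δ * θ ^ k ≤ 2 * B := by nlinarith [pow_nonneg hθ k]
    exact mul_le_mul_of_nonneg_right this hrOp
  have hm0 : 0 ≤ δ * θ ^ k * rOp k := by positivity
  have key := norm_le_two_constants_disc_of_norm_le (f := fun z => opA g k (γ z) - opB g k (γ z)) hdiff (fun z hz => hbd z hz) hm
    hm0 hmM hr hz₀
  rw [hγu] at key
  refine key.trans (le_of_eq ?_)
  -- `(δθ^k r)^{1−l} (2B r)^l = δ^{1−l} (2B)^l (θ^{1−l})^k r`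
  rw [← hl]
  have hl0 : 0 ≤ l := by
    rw [hl]
    have : 0 ≤ Real.arctan (2 * r / (1 - r ^ 2)) := by
      rcases le_or_gt 0 (2 * r / (1 - r ^ 2)) with h | h
      · rw [← Real.arctan_zero]; exact Real.arctan_strictMono.monotone h
      · have hr0 : 0 ≤ r := (norm_nonneg z₀).trans hz₀
        have h1 : 0 < 1 - r ^ 2 := by nlinarith
        have : 0 ≤ 2 * r / (1 - r ^ 2) := div_nonneg (by linarith) h1.le
        linarith
    positivity
  rw [Real.mul_rpow (by positivity) hrOp, Real.mul_rpow hδ (pow_nonneg hθ k), Real.mul_rpow hB hrOp,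
    ← Real.rpow_natCast (θ ^ (1 - l)) k, ← Real.rpow_mul hθ, mul_comm (1 - l) (k : ℝ), Real.rpow_mul hθ, Real.rpow_natCast]
  -- collect the `rOp k` powers: r^{1−l} · r^{l} = r
  have hr' : rOp k ^ (1 - l) * rOp k ^ l = rOp k := by
    rcases hrOp.eq_or_lt with h0 | hpos
    · rw [← h0]
      rcases eq_or_ne l 0 with hl0' | hl0'
      · simp [hl0']
      · rw [Real.zero_rpow hl0', mul_zero]
    · rw [← Real.rpow_add hpos]; norm_num
  calc (δ ^ (1 - l) * (θ ^ k) ^ (1 - l) * rOp k ^ (1 - l)) * ((2 * B) ^ l * rOp k ^ l)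
      = δ ^ (1 - l) * (2 * B) ^ l * (θ ^ k) ^ (1 - l) * (rOp k ^ (1 - l) * rOp k ^ l) := by ring
    _ = δ ^ (1 - l) * (2 * B) ^ l * (θ ^ k) ^ (1 - l) * rOp k := by rw [hr']

/-- [folklore] **The same with the two families' slices hypothesised SEPARATELY** (each holomorphic in the open disc, continuous on the closed disc and bounded there by `B·rOp k` —
the form in which an instance supplies print's «analytic … and all the bounds above are uniform on the domain»): the difference is then holomorphic and bounded by `2B·rOp k`. -/
theorem operatorRate_complex_of_realSlice_each {opA opB : (ℕ → ℝ) → ℕ → 𝒰 → Op} {W : Set (ℕ → ℝ)} {real dom : Set 𝒰}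
    {δ θ B r : ℝ} {rOp : ℕ → ℝ} {k : ℕ} (hδ : 0 ≤ δ) (hδB : δ ≤ 2 * B) (hθ : 0 ≤ θ) (hθ1 : θ ≤ 1) (hrOp : 0 ≤ rOp k)
    (hr : r < 1)
    (hreal : ∀ g ∈ W, ∀ u ∈ real, ‖opA g k u - opB g k u‖ ≤ δ * θ ^ k * rOp k)
    (hslice : ∀ g ∈ W, ∀ u ∈ dom, ∃ γ : ℂ → 𝒰, ∃ z₀ : ℂ, ‖z₀‖ ≤ r ∧ γ z₀ = u ∧ (∀ x : ℝ, |x| < 1 → γ x ∈ real) ∧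
      DiffContOnCl ℂ (fun z => opA g k (γ z)) (ball 0 1) ∧ DiffContOnCl ℂ (fun z => opB g k (γ z)) (ball 0 1) ∧
        (∀ z : ℂ, ‖z‖ ≤ 1 → ‖opA g k (γ z)‖ ≤ B * rOp k) ∧ ∀ z : ℂ, ‖z‖ ≤ 1 → ‖opB g k (γ z)‖ ≤ B * rOp k) :
    ∀ g ∈ W, ∀ u ∈ dom, ‖opA g k u - opB g k u‖ ≤
      (δ ^ (1 - 2 / π * Real.arctan (2 * r / (1 - r ^ 2))) * (2 * B) ^ (2 / π * Real.arctan (2 * r / (1 - r ^ 2)))) *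
        (θ ^ (1 - 2 / π * Real.arctan (2 * r / (1 - r ^ 2)))) ^ k * rOp k := by
  refine operatorRate_complex_of_realSlice hδ hδB hθ hθ1 hrOp hr hreal fun g hg u hu => ?_
  obtain ⟨γ, z₀, hz₀, hγu, hγreal, hA, hB, hbA, hbB⟩ := hslice g hg u hu
  refine ⟨γ, z₀, hz₀, hγu, hγreal, hA.sub hB, fun z hz => ?_⟩
  calc ‖opA g k (γ z) - opB g k (γ z)‖ ≤ ‖opA g k (γ z)‖ + ‖opB g k (γ z)‖ := norm_sub_le _ _
    _ ≤ B * rOp k + B * rOp k := add_le_add (hbA z hz) (hbB z hz)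
    _ = 2 * B * rOp k := by ring

/-- [folklore] **ALL LEVELS, ONE DEPTH AND ONE BOUND — the consumer's shape.**  With the depth `r` and the bound letter `B` fixed OUTSIDE the level, the per-level junction
assembles into exactly the right-hand side of `OutputRateFunctionalTablesFamily.FamilySlots.operatorRate_iff_pointwise` (W1 of the family model at EVERY chart point) with the
LEVEL-FREE pair `(δ′, θ′) = (δ^{1−λ}·(2B)^{λ}, θ^{1−λ})`. -/
theorem operatorRate_complex_of_realSlice_all {opA opB : (ℕ → ℝ) → ℕ → 𝒰 → Op} {W : Set (ℕ → ℝ)} {real dom : Set 𝒰}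
    {δ θ B r : ℝ} {rOp : ℕ → ℝ} (hδ : 0 ≤ δ) (hδB : δ ≤ 2 * B) (hθ : 0 ≤ θ) (hθ1 : θ ≤ 1) (hrOp : ∀ k, 0 ≤ rOp k)
    (hr : r < 1)
    (hreal : ∀ k, ∀ g ∈ W, ∀ u ∈ real, ‖opA g k u - opB g k u‖ ≤ δ * θ ^ k * rOp k)
    (hslice : ∀ k, ∀ g ∈ W, ∀ u ∈ dom, ∃ γ : ℂ → 𝒰, ∃ z₀ : ℂ, ‖z₀‖ ≤ r ∧ γ z₀ = u ∧ (∀ x : ℝ, |x| < 1 → γ x ∈ real) ∧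
      DiffContOnCl ℂ (fun z => opA g k (γ z) - opB g k (γ z)) (ball 0 1) ∧
        ∀ z : ℂ, ‖z‖ ≤ 1 → ‖opA g k (γ z) - opB g k (γ z)‖ ≤ 2 * B * rOp k) :
    ∀ k, ∀ g ∈ W, ∀ u ∈ dom, ‖opA g k u - opB g k u‖ ≤
      (δ ^ (1 - 2 / π * Real.arctan (2 * r / (1 - r ^ 2))) * (2 * B) ^ (2 / π * Real.arctan (2 * r / (1 - r ^ 2)))) *
        (θ ^ (1 - 2 / π * Real.arctan (2 * r / (1 - r ^ 2)))) ^ k * rOp k :=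
  fun k => operatorRate_complex_of_realSlice hδ hδB hθ hθ1 (hrOp k) hr (hreal k) (hslice k)

end Summit.QuantumFields.BalabanUV.T4Continuum.OutputRateComplexSlice

end
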